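import Literature.NumberTheory.EllipticCurves.Kato2004.LocalIwasawaCohomologyPoitouTate
import Literature.NumberTheory.EllipticCurves.Sprung2012.SharpFlatSelmerDualRestrictionProofs
import Literature.NumberTheory.EllipticCurves.KatoFineSelmerDualProofs
import Literature.NumberTheory.EllipticCurves.IwasawaSelmerDualProofs
import Literature.NumberTheory.EllipticCurves.IwasawaAlgebraProofs
import HarnessLib

/-!
# Poitou–Tate exactness on Kato's carriers (the named fact `exists_lambdaAdicLocalTatePairing_poitouTate_exact`, every `p`):
# its first kernel consequences — the g4 fact by projection; `μ(X(E/ℚ_∞)) = 0` forces a `μ`-FREE VALUE of every normalised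
# ordinary-kernel functional on `loc 𝐇¹_Γ`; `X ↠ X₀` transports finite generation over `ℤ_p` — proofs only

Sibling proof file (D-0014: theorems only, no definition, no named fact, no `sorry`, no instance) of
`LocalIwasawaCohomologyPoitouTate.lean` (p729889; audit-2 sheet hPTE: PASS). Topic `NumberTheory/EllipticCurves/Kato2004` (namespace = path).
Written by the width seat `cruxlead-stmt-BirchSwinnertonDyer-19573-w3` g6 (cell `pub/bsd-2adic`) for the line `steinberg-fibre-at-two` of
crux `OrdKatoHalfAtTwoIso` (`Summits/BirchSwinnertonDyer`, item 19573, child 24097), but NOTHING here is specific to any summit: every statement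
is about the tree's Literature objects (`IwasawaH1Data`, `LocalIwasawaH1Data`, `SelmerDualData`, `FineSelmerDualData`) at an arbitrary prime `p`.
HONEST FRAMING: CONDITIONAL on the named fact where it appears as a hypothesis; BSD is not proved by any of this.

## What is proved
* §1 algebra over `Λ = ℤ_p⟦X⟧` (no facts): a `Λ`-module finitely generated over `ℤ_p` is met by `X`-MONIC relations
  (`exists_monic_smul_eq_zero_of_moduleFinite`: the chain `ℤ_p⟨m, Xm, …, X^{k−1}m⟩` stabilises — Noetherianity of `ℤ_p`), hence is
  `Λ`-torsion (`isTorsion_of_moduleFinite_restrictScalars`); KEY LEMMA `mem_augIdealP_of_addMonoidHom_of_moduleFinite`: an ADDITIVE map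
  `F : P₀ → X′` commuting with the constants `C c`, into such an `X′`, and a `Λ`-linear `col : P₀ → Λ` with `col(ker F) ⊆ (p)` force
  `col(P₀) ⊆ (p)` (`X`-monic `g ∉ (p)` with `F (g • x) = 0`, `g · col x ∈ (p)`, `(p)` prime).
* §2 `exists_addMonoidHom_transpose_selmerDual`: from clause (C) of the pairing (constants act through `ℤ_p → ℤ/p^k` on torsion values), the
  additive transpose `F : P₀ → D.X`, `D.toDual (F x) s = toDualP x s`, commuting with `C c` (every Selmer class is `p^k`-torsion); its kernel
  is `Sel^⊥` (`transpose_eq_zero_iff`).  (The `X`-adjointness (T) makes `F` `ι`-semilinear — not needed here.)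
* §3 `exists_notMem_augIdealP_col_loc_of_moduleFinite` (per datum, abstract carriers): (C) + the EXACTNESS clause (E) «`Sel^⊥ ⊆ range ordInc +
  range ℓ₀`» + `D.X` finitely generated over `ℤ_p` + `col ∘ ordInc = 0` + a value outside `(p)` ⇒ a value outside `(p)` on `range ℓ₀`.
* §4 on Kato's carriers: `exists_lambdaAdicLocalTatePairing_selmer_orthogonal_of_poitouTate_exact` (the g4 fact p723619 is the projection of
  p729889); `exists_notMem_col_loc_of_poitouTate_of_moduleFinite` (fact + `X` f.g./`ℤ_p` ⇒ every `Λ`-linear `col` killing `range(J′ → J)` with a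
  value outside `(p)` has one on `loc_v 𝐇¹_Γ` — for torsion `X`, «`μ(X) = 0`» is Greenberg's Conjecture 1.11, a HYPOTHESIS here);
  `moduleFinite_fineSelmerDual_of_moduleFinite_selmerDual` (`X ↠ X₀`, Sprung2012's `exists_linearMap_ofSelmerDual`: finite generation over `ℤ_p`
  passes to the fine dual — Conjecture A at `(W, p)`).
In print this is the `⇒` half of «`μ(X) = μ(coarse) + μ(fine)`» for the Poitou–Tate sequence
`0 → 𝐇¹_{loc,Γ}/(range F⁺ + loc 𝐇¹_Γ) → X → X₀ → 0` ([GreenbergLNM1716, §4 p. 122]; [Kato2004Asterisque, (17.13.1)–(17.13.2)]).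

References: [GreenbergLNM1716] Conj. 1.11 (p. 64), §4 pp. 121–122; [Kato2004Asterisque] §17.13 (p. 279); [MilneADT2006] I Thm. 4.10; [Harari2020]
Thm. 17.13 (c); [Washington1997] §13.2; [CoatesSujatha2005] Conj. A. Tree: `LocalIwasawaCohomologyPoitouTate.lean`, `IwasawaSelmerDualProofs.lean`
(`exists_pow_smul_subgroupH1_ker_eq_zero`, `nonempty_selmerDualData_holds`), `Sprung2012/SharpFlatSelmerDualRestrictionProofs.lean`.
-/

set_option autoImplicit false

noncomputable section

open scoped Classical NumberField
open Field IsDedekindDomain WeierstrassCurve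
open Literature.NumberTheory.GaloisRepresentations
open Literature.NumberTheory.EllipticCurves Literature.NumberTheory.EllipticCurves.GreenbergSelmer
open Literature.NumberTheory.EllipticCurves.Kato2004.EulerSystemValues

namespace Literature.NumberTheory.EllipticCurves.Kato2004

/-! ## §1 Algebra over `Λ = ℤ_p⟦X⟧`: modules finitely generated over `ℤ_p` are met by `X`-monic relations -/

section Algebra

variable {p : ℕ} [Fact p.Prime]

/-- An `X`-monic combination `Xⁿ − Σ_{i<n} cᵢ Xⁱ` is not in `(p)`: its `n`-th coefficient is `1` (a distinguished-type element has
`μ = 0`, Washington §13.1–13.2). [cite: Washington1997, §13.2] -/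
theorem X_pow_sub_sum_notMem_augIdealP (n : ℕ) (c : Fin n → ℤ_[p]) :
    (PowerSeries.X : IwasawaAlgebra p) ^ n - ∑ i : Fin n, PowerSeries.C (c i) * PowerSeries.X ^ (i : ℕ) ∉
      IwasawaAlgebra.augIdealP p := by
  intro h
  rw [IwasawaAlgebra.augIdealP, Ideal.mem_span_singleton] at h
  obtain ⟨q, hq⟩ := h
  have hsum : ∑ i : Fin n, PowerSeries.coeff n (PowerSeries.C (c i) * (PowerSeries.X : IwasawaAlgebra p) ^ (i : ℕ)) = 0 :=
    Finset.sum_eq_zero fun i _ => by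
      rw [PowerSeries.coeff_C_mul, PowerSeries.coeff_X_pow, if_neg (Nat.ne_of_gt i.isLt), mul_zero]
  have hc := congr_arg (PowerSeries.coeff n) hq
  rw [map_sub, map_sum, PowerSeries.coeff_X_pow, if_pos rfl, hsum, sub_zero, PowerSeries.coeff_C_mul] at hc
  exact (PadicInt.irreducible_p (p := p)).not_isUnit (isUnit_of_dvd_one ⟨_, hc⟩)

/-- **A module over `Λ` that is finitely generated over `ℤ_p` is met by `X`-monic relations**: for every `m` there are `n` and
constants `cᵢ` with `(Xⁿ − Σ_{i<n} cᵢ Xⁱ) • m = 0` (the ascending chain `ℤ_p⟨m, Xm, …, X^{k−1}m⟩` stabilises, `ℤ_p` being Noetherian).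
[cite: Washington1997, §13.2] -/
theorem exists_monic_smul_eq_zero_of_moduleFinite {M : Type*} [AddCommGroup M] [Module (IwasawaAlgebra p) M]
    (hfin : Module.Finite ℤ_[p] (RestrictScalars ℤ_[p] (IwasawaAlgebra p) M)) (m : M) :
    ∃ (n : ℕ) (c : Fin n → ℤ_[p]),
      ((PowerSeries.X : IwasawaAlgebra p) ^ n - ∑ i : Fin n, PowerSeries.C (c i) * PowerSeries.X ^ (i : ℕ)) • m = 0 := by
  classical
  letI : Module ℤ_[p] M := Module.compHom M (algebraMap ℤ_[p] (IwasawaAlgebra p))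
  haveI : IsScalarTower ℤ_[p] (IwasawaAlgebra p) M := IsScalarTower.of_compHom ℤ_[p] _ M
  haveI : Module.Finite ℤ_[p] M := hfin
  haveI : IsNoetherian ℤ_[p] M := isNoetherian_of_isNoetherianRing_of_finite ℤ_[p] M
  let v : ℕ → M := fun j => (PowerSeries.X : IwasawaAlgebra p) ^ j • m
  let N : ℕ →o Submodule ℤ_[p] M :=
    { toFun := fun k => Submodule.span ℤ_[p] (Set.range fun i : Fin k => v i)
      monotone' := fun k l hkl => Submodule.span_mono (by
        rintro _ ⟨i, rfl⟩
        exact ⟨Fin.castLE hkl i, rfl⟩) }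
  obtain ⟨n, hn⟩ := (monotone_stabilizes_iff_noetherian.mpr inferInstance) N
  have hmem : v n ∈ N n := by
    rw [hn (n + 1) (Nat.le_succ n)]
    exact Submodule.subset_span ⟨⟨n, Nat.lt_succ_self n⟩, rfl⟩
  obtain ⟨c, hc⟩ := (Submodule.mem_span_range_iff_exists_fun ℤ_[p]).mp hmem
  refine ⟨n, c, ?_⟩
  have hv : ∀ i : Fin n, c i • v i = (PowerSeries.C (c i) * PowerSeries.X ^ (i : ℕ)) • m := by
    intro i
    change algebraMap ℤ_[p] (IwasawaAlgebra p) (c i) • ((PowerSeries.X : IwasawaAlgebra p) ^ (i : ℕ) • m) = _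
    rw [mul_smul, PowerSeries.C_eq_algebraMap]
  rw [sub_smul, Finset.sum_smul, sub_eq_zero]
  change v n = _
  rw [← hc]
  exact Finset.sum_congr rfl fun i _ => hv i

/-- **Corollary: a `Λ`-module finitely generated over `ℤ_p` is `Λ`-torsion** (the monic relation is a non-zero element of the
domain `Λ`). [cite: Washington1997, §13.2] -/
theorem isTorsion_of_moduleFinite_restrictScalars {M : Type*} [AddCommGroup M] [Module (IwasawaAlgebra p) M]
    (hfin : Module.Finite ℤ_[p] (RestrictScalars ℤ_[p] (IwasawaAlgebra p) M)) :
    Module.IsTorsion (IwasawaAlgebra p) M := by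
  intro m
  obtain ⟨n, c, hg⟩ := exists_monic_smul_eq_zero_of_moduleFinite hfin m
  refine ⟨⟨_, mem_nonZeroDivisors_of_ne_zero ?_⟩, hg⟩
  intro h0
  exact X_pow_sub_sum_notMem_augIdealP n c (by rw [h0]; exact Ideal.zero_mem _)

/-- **KEY LEMMA.** Let `F : P₀ → X'` be ADDITIVE and commute with the constants (`F (C c • x) = C c • F x`) into a `Λ`-module `X'` finitely
generated over `ℤ_p`, and `col : P₀ → Λ` a `Λ`-linear functional with `col(ker F) ⊆ (p)`.  Then `col(P₀) ⊆ (p)`: the chain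
`ℤ_p⟨F x, F (X x), …⟩` gives an `X`-monic `g ∉ (p)` with `F (g • x) = 0`, so `g · col x ∈ (p)`, and `(p)` is prime — the algebra under
«`μ(X) = 0` ⟹ `μ`(coarse) `= 0`» for the Poitou–Tate sequence. [cite: Washington1997, §13.2] [cite: GreenbergLNM1716, §4 p. 122 (the sequence)] -/
theorem mem_augIdealP_of_addMonoidHom_of_moduleFinite
    {P₀ : Type*} [AddCommGroup P₀] [Module (IwasawaAlgebra p) P₀]
    {X' : Type*} [AddCommGroup X'] [Module (IwasawaAlgebra p) X']
    (hfin : Module.Finite ℤ_[p] (RestrictScalars ℤ_[p] (IwasawaAlgebra p) X'))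
    (F : P₀ →+ X') (hFC : ∀ (c : ℤ_[p]) (x : P₀), F (PowerSeries.C c • x) = PowerSeries.C c • F x)
    (col : P₀ →ₗ[IwasawaAlgebra p] IwasawaAlgebra p)
    (hker : ∀ x : P₀, F x = 0 → col x ∈ IwasawaAlgebra.augIdealP p) (x : P₀) :
    col x ∈ IwasawaAlgebra.augIdealP p := by
  classical
  letI : Module ℤ_[p] X' := Module.compHom X' (algebraMap ℤ_[p] (IwasawaAlgebra p))
  haveI : IsScalarTower ℤ_[p] (IwasawaAlgebra p) X' := IsScalarTower.of_compHom ℤ_[p] _ X'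
  haveI : Module.Finite ℤ_[p] X' := hfin
  haveI : IsNoetherian ℤ_[p] X' := isNoetherian_of_isNoetherianRing_of_finite ℤ_[p] X'
  let v : ℕ → X' := fun j => F ((PowerSeries.X : IwasawaAlgebra p) ^ j • x)
  let N : ℕ →o Submodule ℤ_[p] X' :=
    { toFun := fun k => Submodule.span ℤ_[p] (Set.range fun i : Fin k => v i)
      monotone' := fun k l hkl => Submodule.span_mono (by
        rintro _ ⟨i, rfl⟩
        exact ⟨Fin.castLE hkl i, rfl⟩) }
  obtain ⟨n, hn⟩ := (monotone_stabilizes_iff_noetherian.mpr inferInstance) N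
  have hmem : v n ∈ N n := by
    rw [hn (n + 1) (Nat.le_succ n)]
    exact Submodule.subset_span ⟨⟨n, Nat.lt_succ_self n⟩, rfl⟩
  obtain ⟨c, hc⟩ := (Submodule.mem_span_range_iff_exists_fun ℤ_[p]).mp hmem
  have hv : ∀ i : Fin n, c i • v i = F ((PowerSeries.C (c i) * PowerSeries.X ^ (i : ℕ)) • x) := by
    intro i
    change algebraMap ℤ_[p] (IwasawaAlgebra p) (c i) • F ((PowerSeries.X : IwasawaAlgebra p) ^ (i : ℕ) • x) = _
    rw [mul_smul, hFC, PowerSeries.C_eq_algebraMap]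
  have hFg : F (((PowerSeries.X : IwasawaAlgebra p) ^ n - ∑ i : Fin n, PowerSeries.C (c i) * PowerSeries.X ^ (i : ℕ)) • x) = 0 := by
    rw [sub_smul, Finset.sum_smul, map_sub, map_sum, sub_eq_zero]
    change v n = _
    rw [← hc]
    exact Finset.sum_congr rfl fun i _ => hv i
  have hmemg := hker _ hFg
  rw [map_smul, smul_eq_mul] at hmemg
  exact ((IwasawaAlgebra.isPrime_augIdealP_holds p).mem_or_mem hmemg).resolve_left (X_pow_sub_sum_notMem_augIdealP n c)

end Algebra

/-! ## §2 The additive transpose into a Selmer dual datum, from clause (C) of the pairing -/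

section Transpose

variable {p : ℕ} [Fact p.Prime] {W : WeierstrassCurve ℚ} {κ : ZpExtension ℚ p} {γ : absoluteGaloisGroup ℚ}

/-- **The additive transpose `F : P₀ → X(E/ℚ_∞)` of a pairing whose constants act through `ℤ_p → ℤ/p^k`.**  For a `Λ`-module `P₀` (print:
`𝐇¹_{loc,Γ}(T_pW)`) with an additive `toDualP : P₀ → Hom(H¹(ker κ, E[p^∞]), ℚ/ℤ)` satisfying clause (C) of the fact, and a Selmer dual datum `D`
(`X = Hom(Sel_{p^∞}(E/ℚ_∞), ℚ/ℤ)`): `F x := D.toDual⁻¹ (toDualP x |_{Sel})` is additive, `D.toDual (F x) s = toDualP x s`, and commutes with the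
constants (`D.toDual_C_smul`; every Selmer class is `p^k`-torsion, `exists_pow_smul_subgroupH1_ker_eq_zero`).
[cite: GreenbergLNM1716, §1 p. 60 (X as a Pontryagin dual)] -/
theorem exists_addMonoidHom_transpose_selmerDual (D : W.SelmerDualData κ γ)
    {P₀ : Type*} [AddCommGroup P₀] [Module (IwasawaAlgebra p) P₀]
    (toDualP : P₀ →+ (W.subgroupH1 p κ.kerSubgroup →+ AddCircle (1 : ℚ)))
    (hC : ∀ (c : ℤ_[p]) (x : P₀) (s : W.subgroupH1 p κ.kerSubgroup) (k : ℕ), p ^ k • toDualP x s = 0 →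
      toDualP (PowerSeries.C c • x) s = (PadicInt.toZModPow k c).val • toDualP x s) :
    ∃ F : P₀ →+ D.X,
      (∀ (x : P₀) (s : W.selmerInfty κ), D.toDual (F x) s = toDualP x (s : W.subgroupH1 p κ.kerSubgroup)) ∧
      ∀ (c : ℤ_[p]) (x : P₀), F (PowerSeries.C c • x) = PowerSeries.C c • F x := by
  let e : D.X ≃+ (W.selmerInfty κ →+ AddCircle (1 : ℚ)) := AddEquiv.ofBijective D.toDual D.bijective
  let r : P₀ →+ (W.selmerInfty κ →+ AddCircle (1 : ℚ)) :=
    { toFun := fun x => (toDualP x).comp (W.selmerInfty κ).subtype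
      map_zero' := by rw [map_zero, AddMonoidHom.zero_comp]
      map_add' := fun x y => by rw [map_add, AddMonoidHom.add_comp] }
  let F : P₀ →+ D.X := e.symm.toAddMonoidHom.comp r
  have hF : ∀ (x : P₀) (s : W.selmerInfty κ), D.toDual (F x) s = toDualP x (s : W.subgroupH1 p κ.kerSubgroup) := by
    intro x s
    change e (e.symm (r x)) s = _
    rw [AddEquiv.apply_symm_apply]
    rfl
  refine ⟨F, hF, fun c x => ?_⟩
  apply D.bijective.1
  ext s
  obtain ⟨k, hk⟩ := W.exists_pow_smul_subgroupH1_ker_eq_zero κ (s : W.subgroupH1 p κ.kerSubgroup)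
  have hks : p ^ k • s = 0 := Subtype.ext (by rw [AddSubgroupClass.coe_nsmul]; exact hk)
  have hkv : p ^ k • toDualP x (s : W.subgroupH1 p κ.kerSubgroup) = 0 := by rw [← map_nsmul, hk, map_zero]
  rw [hF, D.toDual_C_smul c (F x) s k hks, hF, hC c x _ k hkv]

/-- **The kernel of the transpose** is the orthogonal of `Sel` (`D.toDual` is injective: `X` IS the Pontryagin dual).
[cite: GreenbergLNM1716, §1 p. 60 (X as a Pontryagin dual)] -/
theorem transpose_eq_zero_iff (D : W.SelmerDualData κ γ)
    {P₀ : Type*} [AddCommGroup P₀] [Module (IwasawaAlgebra p) P₀]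
    (toDualP : P₀ →+ (W.subgroupH1 p κ.kerSubgroup →+ AddCircle (1 : ℚ))) (F : P₀ →+ D.X)
    (hF : ∀ (x : P₀) (s : W.selmerInfty κ), D.toDual (F x) s = toDualP x (s : W.subgroupH1 p κ.kerSubgroup)) (x : P₀) :
    F x = 0 ↔ ∀ s : W.selmerInfty κ, toDualP x (s : W.subgroupH1 p κ.kerSubgroup) = 0 := by
  constructor
  · intro hx s
    rw [← hF, hx, map_zero, AddMonoidHom.zero_apply]
  · intro hx
    apply D.bijective.1
    rw [map_zero]
    ext s
    rw [hF, hx, AddMonoidHom.zero_apply]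

end Transpose

/-! ## §3 Per datum: `X` finitely generated over `ℤ_p` forces a value outside `(p)` on `range ℓ₀` -/

section PerDatum

variable {p : ℕ} [Fact p.Prime] {W : WeierstrassCurve ℚ} {κ : ZpExtension ℚ p} {γ : absoluteGaloisGroup ℚ}

/-- **PER DATUM (every `p`; algebra over the pairing's clauses (C) and (E)).**  Data: a `Λ`-module `P₀` (print `𝐇¹_{loc,Γ}(T_pW)`), `Λ`-linear
`ordInc : P₁ → P₀` (print `𝐇¹_{loc,Γ}(F⁺T) → 𝐇¹_{loc,Γ}(T)`) and `ℓ₀ : IH → P₀` (print `loc_v` on `𝐇¹_Γ`), an additive `toDualP` with (C) and the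
EXACTNESS clause (E) «`x ⊥ Sel ⇒ x ∈ range ordInc + range ℓ₀`»; a Selmer dual datum `D` with `D.X` FINITELY GENERATED OVER `ℤ_p` (for torsion
`X`: `μ(X) = 0`); a `Λ`-linear `col : P₀ → Λ` killing `range ordInc`.  THEN a value of `col` outside `(p)` forces one on `range ℓ₀` (else
`col(ker F) ⊆ (p)` for the transpose `F` of §2, and §1 gives `col(P₀) ⊆ (p)`). [cite: GreenbergLNM1716, Conj. 1.11 (p. 64) and §4 p. 122 (shape)] -/
theorem exists_notMem_augIdealP_col_loc_of_moduleFinite (D : W.SelmerDualData κ γ)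
    (hfin : Module.Finite ℤ_[p] (RestrictScalars ℤ_[p] (IwasawaAlgebra p) D.X))
    {P₀ : Type*} [AddCommGroup P₀] [Module (IwasawaAlgebra p) P₀]
    {P₁ : Type*} [AddCommGroup P₁] [Module (IwasawaAlgebra p) P₁]
    {IH : Type*} [AddCommGroup IH] [Module (IwasawaAlgebra p) IH]
    (ordInc : P₁ →ₗ[IwasawaAlgebra p] P₀) (ℓ₀ : IH →ₗ[IwasawaAlgebra p] P₀)
    (toDualP : P₀ →+ (W.subgroupH1 p κ.kerSubgroup →+ AddCircle (1 : ℚ)))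
    (hC : ∀ (c : ℤ_[p]) (x : P₀) (s : W.subgroupH1 p κ.kerSubgroup) (k : ℕ), p ^ k • toDualP x s = 0 →
      toDualP (PowerSeries.C c • x) s = (PadicInt.toZModPow k c).val • toDualP x s)
    (hE : ∀ x : P₀, (∀ s : W.selmerInfty κ, toDualP x (s : W.subgroupH1 p κ.kerSubgroup) = 0) →
      ∃ (y : P₁) (g : IH), x = ordInc y + ℓ₀ g)
    (col : P₀ →ₗ[IwasawaAlgebra p] IwasawaAlgebra p) (hcol : ∀ y : P₁, col (ordInc y) = 0)
    (hnorm : ∃ x : P₀, col x ∉ IwasawaAlgebra.augIdealP p) :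
    ∃ g : IH, col (ℓ₀ g) ∉ IwasawaAlgebra.augIdealP p := by
  by_contra hall
  have hall' : ∀ g : IH, col (ℓ₀ g) ∈ IwasawaAlgebra.augIdealP p := fun g =>
    Classical.byContradiction fun hg => hall ⟨g, hg⟩
  obtain ⟨F, hF, hFC⟩ := exists_addMonoidHom_transpose_selmerDual D toDualP hC
  have hker : ∀ x : P₀, F x = 0 → col x ∈ IwasawaAlgebra.augIdealP p := by
    intro x hx
    obtain ⟨y, g, rfl⟩ := hE x ((transpose_eq_zero_iff D toDualP F hF x).mp hx)
    rw [map_add, hcol, zero_add]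
    exact hall' g
  obtain ⟨x₀, hx₀⟩ := hnorm
  exact hx₀ (mem_augIdealP_of_addMonoidHom_of_moduleFinite hfin F hFC col hker x₀)

end PerDatum

/-! ## §4 On Kato's carriers -/

/-- **The g4 fact is the projection of the g6 fact** (drop clause (E)): every consumer of
`exists_lambdaAdicLocalTatePairing_selmer_orthogonal` (p723619) is served by `exists_lambdaAdicLocalTatePairing_poitouTate_exact`.
[cite: MilneADT2006, Ch. I Cor. 2.3 and Thm. 4.10] [cite: GreenbergLNM1716, §2 Prop. 2.2 (p. 73), §4 p. 122] -/
theorem exists_lambdaAdicLocalTatePairing_selmer_orthogonal_of_poitouTate_exact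
    (h : exists_lambdaAdicLocalTatePairing_poitouTate_exact) : exists_lambdaAdicLocalTatePairing_selmer_orthogonal := by
  intro p _ W _ _ _ _ _ κ γ hκ hγ hord v hv γᵥ hsurj hγᵥ I J J'
  obtain ⟨toDualP, hK, hT, hC, hS, hI, hR, -⟩ := h p W κ γ hκ hγ hord v hv γᵥ hsurj hγᵥ I J J'
  exact ⟨toDualP, hK, hT, hC, hS, hI, hR⟩

/-- **ON KATO'S CARRIERS, every `p`: `X(E/ℚ_∞)` finitely generated over `ℤ_p` ⟹ every NORMALISED ordinary-kernel functional takes a value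
outside `(p)` on `loc_v 𝐇¹_Γ(T_pW)`.**  From the Poitou–Tate fact (clauses (C)(E)) and the finite generation of `X = D.X` over `ℤ_p` (for torsion
`X`: `μ(X) = 0`, Greenberg's Conjecture 1.11 — a HYPOTHESIS), for all pinned carriers `I, J, J'` and every `Λ`-linear `col : J.H → Λ` killing
`range(J′ → J)` with some value outside `(p)`: some `y ∈ 𝐇¹_Γ` has `col (loc_v y) ∉ (p)`.  CONDITIONAL; nothing about any curve is asserted.
[cite: GreenbergLNM1716, Conj. 1.11 (p. 64), §4 p. 122] [cite: MilneADT2006, I Thm. 4.10] [cite: Kato2004Asterisque, §17.13 (17.13.1)–(17.13.2) (p. 279)] -/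
theorem exists_notMem_col_loc_of_poitouTate_of_moduleFinite (hPT : exists_lambdaAdicLocalTatePairing_poitouTate_exact)
    {p : ℕ} [Fact p.Prime] (W : WeierstrassCurve ℚ) [W.IsElliptic] [W.IsGloballyMinimal]
    [ContinuousSMul ℤ_[p] (W.tateModule p)] [Module.Free ℤ_[p] (W.tateModule p)] [Module.Finite ℤ_[p] (W.tateModule p)]
    (κ : ZpExtension ℚ p) (γ : absoluteGaloisGroup ℚ) (hκ : κ.IsCyclotomic) (hγ : κ.IsTopGenerator γ) (hord : IsOrdinaryAt W p)
    (v : HeightOneSpectrum (𝓞 ℚ)) (hv : ((p : ℕ) : 𝓞 ℚ) ∈ v.asIdeal) (γᵥ : absoluteGaloisGroup (v.adicCompletion ℚ))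
    (hsurj : Function.Surjective
      (κ.toContinuousMonoidHom.comp (resGalOfEmb (closureEmb (K := ℚ) (v.adicCompletion ℚ)))))
    (hγᵥ : κ.IsTopGenerator (resGalOfEmb (closureEmb (K := ℚ) (v.adicCompletion ℚ)) γᵥ))
    (I : IwasawaH1Data W p κ γ) (J : LocalIwasawaH1Data κ v ((tateRep W p).toLocal v) γᵥ)
    (J' : LocalIwasawaH1Data κ v (tateLocalOrdinaryRep W p v) γᵥ)
    (D : W.SelmerDualData κ γ) (hfin : Module.Finite ℤ_[p] (RestrictScalars ℤ_[p] (IwasawaAlgebra p) D.X))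
    (col : J.H →ₗ[IwasawaAlgebra p] IwasawaAlgebra p)
    (hker : ∀ y : J'.H, col (J'.ordinaryInclusion J y) = 0) (hnorm : ∃ x : J.H, col x ∉ IwasawaAlgebra.augIdealP p) :
    ∃ y : I.H, col (I.loc J hsurj hγ hγᵥ y) ∉ IwasawaAlgebra.augIdealP p := by
  obtain ⟨toDualP, -, -, hC, -, -, -, hE⟩ := hPT p W κ γ hκ hγ hord v hv γᵥ hsurj hγᵥ I J J'
  exact exists_notMem_augIdealP_col_loc_of_moduleFinite D hfin (J'.ordinaryInclusion J) (I.loc J hsurj hγ hγᵥ)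
    toDualP hC hE col hker hnorm

/-- **`X ↠ X₀` transports finite generation over `ℤ_p`** (`FineSelmerDualData.exists_linearMap_ofSelmerDual`, the transpose of `Sel₀ ≤ Sel`): if
`X(E/ℚ_∞)` is finitely generated over `ℤ_p` then so is `X₀(E/ℚ_∞)` (Conjecture A at `(W, p)`), for any elliptic `W` and any key.
[cite: CoatesSujatha2005, §3 (Conj. A, shape)] [cite: GreenbergLNM1716, §1 p. 60] -/
theorem moduleFinite_fineSelmerDual_of_moduleFinite_selmerDual {p : ℕ} [Fact p.Prime] {W : WeierstrassCurve ℚ} [W.IsElliptic]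
    {κ : ZpExtension ℚ p} {γ : absoluteGaloisGroup ℚ} (D : W.SelmerDualData κ γ) (Y : W.FineSelmerDualData κ γ)
    (hfin : Module.Finite ℤ_[p] (RestrictScalars ℤ_[p] (IwasawaAlgebra p) D.X)) :
    Module.Finite ℤ_[p] (RestrictScalars ℤ_[p] (IwasawaAlgebra p) Y.X) := by
  obtain ⟨π, hπs, -⟩ := WeierstrassCurve.FineSelmerDualData.exists_linearMap_ofSelmerDual W κ D Y
  letI : Module ℤ_[p] D.X := Module.compHom D.X (algebraMap ℤ_[p] (IwasawaAlgebra p))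
  haveI : IsScalarTower ℤ_[p] (IwasawaAlgebra p) D.X := IsScalarTower.of_compHom ℤ_[p] _ D.X
  letI : Module ℤ_[p] Y.X := Module.compHom Y.X (algebraMap ℤ_[p] (IwasawaAlgebra p))
  haveI : IsScalarTower ℤ_[p] (IwasawaAlgebra p) Y.X := IsScalarTower.of_compHom ℤ_[p] _ Y.X
  haveI : Module.Finite ℤ_[p] D.X := hfin
  change Module.Finite ℤ_[p] Y.X
  exact Module.Finite.of_surjective (π.restrictScalars ℤ_[p]) hπs

end Literature.NumberTheory.EllipticCurves.Kato2004

end
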